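import Summits.BirchSwinnertonDyer.Rank2.IntModelLocalData
import Summits.BirchSwinnertonDyer.Rank2.CountingDoorKernel
import Summits.BirchSwinnertonDyer.BirchSwinnertonDyer.Theorems.ShaPrimaryTransferFiniteShaComponentTransferGoodOrdinaryFive
import Literature.NumberTheory.EllipticCurves.IwasawaLeadingTerm
import Literature.NumberTheory.EllipticCurves.IwasawaLeadingTermProofs
import Literature.NumberTheory.EllipticCurves.CanonicalPAdicHeightHolds
import Literature.NumberTheory.EllipticCurves.NoEverywhereGoodReductionRat
import HarnessLib

/-!
# BirchSwinnertonDyer / ShaPrimaryTransfer — crux `FiniteShaComponentTransfer` (stmt-BirchSwinnertonDyer-22356):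
# the `5`-adic EQUALITY DOOR on Zywina's rank-2 family — `ord_{T=0} L_5(E_{m,n}, T) = 2 ⟺ Ш(E_{m,n})[5^∞]` finite

Companions: `…GoodOrdinaryFive` (`5` is good ordinary on EVERY `E_{m,n}`), `…CrossPrimeRow` (granting Kato 18.4,
the row `(E_{m,n}, 2, q)` closes iff `ord_{T=0} L_q(E_{m,n},T) = 2`; the converse `t_q = 0 ⟹ ord = 2` was recorded
there as NOT available), `…ZywinaBSDRankDoor` (the WINDOW `2 ≤ ord_{T=0} L_p(E_{m,n},T)`), and the cell file
`Summits/BirchSwinnertonDyer/Rank2/RegulatorDoor.lean` (THEOREM R*: Schneider's conjecture at `p ≥ 5` on every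
member of a residue class `zywinaClass p K m₁ M`, from the closed-form `p`-adic heights of the two explicit points).

What this file adds (cell `bsd-rank2`, seat p2 GEN 57 — "the exact extra input that turns `rank ≤ ord_{T=0} L_p`
into equality on an infinite class", as kernel theorems):
* §1 `order_padicLFunction_eq_rank_iff_finite_sha` — ANY `E/ℚ`, `p ≥ 5` good ordinary, `E[p]` irreducible,
  Schneider's conjecture at `p` (`hReg`); granting the prints `Schneider1985_order_charGenerator` (BMS Thm. 1.7) and
  `burungale_castella_skinner_charIdeal_eq_padicLFunction` (BCS Thm. 1.1.2 (a)):
  **`ord_{T=0} L_p(E,T) = rank E(ℚ) ⟺ Ш(E/ℚ)[p^∞]` finite `⟺ t_p(E) = 0`**; and `rank ≤ ord_{T=0} L_p` with no `Ш`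
  or height hypothesis. NO Kato rank bound: both directions are clause 2 of Schneider's theorem through `ι f_E = p^k L_p`.
* §2 `not_isOrdinaryAt_two_zywinaCurve` — `2` (the one prime where `Ш(E_{m,n})[2^∞] = 0` IS a theorem) is a prime
  of BAD (additive) reduction of every `E_{m,n}`: no `2`-adic Mazur–Tate–Teitelbaum door exists on the family.
* §3 `hasIrreducibleModPGaloisRep_five_zywinaCurve` — `7 ∣ n ⟹ E_{m,n}[5]` irreducible: Mazur's Frobenius
  certificate at `ℓ = 7` (`E_{m,n} mod 7 : y² = x³ − 5m x² + 4m² x` has `8` points for each `m ≢ 0 (7)`,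
  kernel-decided, so `a₇ = 0`, and `X² + 7` has no root mod `5`).
* §4 `equalityDoor_five_zywinaCurve`, `window_and_door_five_zywinaCurve` — admissible `(m, n)`, `7 ∣ n`, Schneider
  at `5` (`hReg`), the two prints: **`ord_{T=0} L_5(E_{m,n},T) = 2 ⟺ Ш(E_{m,n})[5^∞]` finite `⟺ t_5 = 0`**, and
  `2 ≤ ord_{T=0} L_5` outright. Rank `= 2`, good ordinary `5`, irreducibility are tree theorems and `hReg` is THEOREM
  R* on the classes `zywinaClass 5 K m₁ M` (`K ≥ 1`, `5 ∤ m₁`, `5^K ∤ m₁⁴ − 1`; `Rank2.schneiderConjecture_of_mem_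
  zywinaClass`, composed in the companion `…ZywinaEqualityDoorClasses`): on those infinite explicit rank-2 classes the
  ONLY non-print input between the window and `5`-adic BSD-rank is `Ш(E_{m,n})[5^∞]`-finiteness, in both directions.
* §5 `order_eq_two_of_transfer_zywinaCurve`, `transfer_instance_iff_order_eq_two` — T = `FiniteShaComponentTransfer`
  (with `t_2(E_{m,n}) = 0`, Zywina) PREDICTS `ord_{T=0} L_5(E_{m,n},T) = 2`, and T's instance `(E_{m,n}, 2, 5)` is
  EQUIVALENT to it — the converse the cross-prime row lacked, without Kato.

PARTITION: r_an ≥ 2 side; summit axis S0 NOT touched (B1 honesty): nothing here bounds an analytic rank or proves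
T, BSD, the main conjecture or Schneider 1985; the prints enter as hypotheses `h85`, `hMC`.
References: P. Schneider, Invent. Math. 79 (1985) Thm. 2′; J. Balakrishnan, J. S. Müller, W. Stein, Math. Comp. 85
(2016) Thm. 1.7; A. Burungale, F. Castella, C. Skinner, arXiv:2405.00270 Thm. 1.1.2 (a); D. Zywina, arXiv:2502.01957
Thm. 1.2, §§3–4; B. Mazur, Invent. Math. 44 (1978) Prop. 6.3; J. H. Silverman, *AEC* (2009) VII.1, VII.5.
-/

-- D-0017: single-problem summit, so `Summit.BirchSwinnertonDyer.BirchSwinnertonDyer.…` repeats a namespace BY DESIGN.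
set_option linter.dupNamespace false

noncomputable section

namespace Summit.BirchSwinnertonDyer.BirchSwinnertonDyer.Theorems.ShaPrimaryTransferZywinaEqualityDoor

open scoped Classical MatrixGroups ModularForm
open CongruenceSubgroup
open Literature.NumberTheory.EllipticCurves Literature.NumberTheory.EllipticCurves.Zywina2025
  Literature.NumberTheory.EllipticCurves.ModularForms
open WeierstrassCurve
open Summit.BirchSwinnertonDyer.BirchSwinnertonDyer.Rank1Residual
open Summit.BirchSwinnertonDyer.Rank1Residual.Additive
open Summit.BirchSwinnertonDyer.BirchSwinnertonDyer.Theses.ShaPrimaryTransfer (FiniteShaComponentTransfer)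
open Summit.BirchSwinnertonDyer.BirchSwinnertonDyer.Theorems.ShaPrimaryTransferGoodOrdinaryFive

/-! ## §1 The equality door for an arbitrary curve: `ord_{T=0} L_p(E,T) = rank ⟺ Ш[p^∞]` finite (given Schneider) -/

section General

variable (W : WeierstrassCurve ℚ) [W.IsElliptic] [W.IsGloballyMinimal] (p : ℕ) [Fact p.Prime]

/-- **The inequality is print-only.** Granting Perrin-Riou–Schneider (clause 1) and the cyclotomic main conjecture
(BCS Thm. 1.1.2 (a)): `rank E(ℚ) ≤ ord_{T=0} L_p(E,T)` at every `p ≥ 5` good ordinary with `E[p]` irreducible —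
no hypothesis on `Ш` or on heights. CONDITIONAL on `h85`, `hMC`. [cite: BalakrishnanMullerStein2015, Thm. 1.7]
[cite: BurungaleCastellaSkinner2025, Thm. 1.1.2 (a)] -/
theorem mordellWeilRank_le_order_padicLFunction_of_prints (h85 : Schneider1985_order_charGenerator)
    (hMC : burungale_castella_skinner_charIdeal_eq_padicLFunction)
    (hp : 5 ≤ p) (hgood : W.HasGoodReductionAtPrime p) (hord : ¬ (p : ℤ) ∣ W.frobeniusTrace p)
    (hirr : W.HasIrreducibleModPGaloisRep p)
    {N : ℕ} [NeZero N] {f : CuspForm (Gamma0 N) 2} (hf : IsNewformOf W f) :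
    (W.mordellWeilRank : ℕ∞) ≤ (padicLFunction f (unitRoot W p : ℚ_[p])).order := by
  obtain ⟨κ, hκ, γ, hγ, hγ'⟩ := exists_isCyclotomic_isTopGenerator_isCyclotomicVariable_holds p
  obtain ⟨D⟩ := W.nonempty_selmerDualData_holds κ γ hγ
  haveI : Module.Finite (IwasawaAlgebra p) D.X := D.module_finite_holds hγ
  obtain ⟨hX, g, k, hchar, hιg⟩ := hMC W p κ γ f hp hgood hord hirr hκ hγ hγ' hf D
  obtain ⟨Dh, hDh⟩ := exists_isCanonical_holds W p hp hgood hord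
  rw [order_eq_order_of_iwasawaToPowerSeries_eq p hιg]
  exact (h85 W p hp hgood hord κ γ hκ hγ hγ' D hX g hchar Dh hDh).1

/-- **THE EQUALITY DOOR (general form).** Let `E/ℚ` (globally minimal `W`) and `p ≥ 5` be a prime of good
ordinary reduction with `E[p]` irreducible, and suppose Schneider's conjecture holds at `p` (`hReg`: the canonical
cyclotomic `p`-adic height is non-degenerate). Granting Perrin-Riou–Schneider (`h85`, clause 2: `ord_{T=0} f_E =
rank ⟺ Reg_p ≠ 0 ∧ Ш[p^∞]` finite) and the main conjecture (`hMC`: `ι f_E = p^k · L_p(f, α, T)`, so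
`ord_{T=0} L_p = ord_{T=0} f_E`): **`ord_{T=0} L_p(E,T) = rank E(ℚ)` if and only if `Ш(E/ℚ)[p^∞]` is finite.**
The Kato rank bound is not used. CONDITIONAL on `h85`, `hMC`. [cite: BalakrishnanMullerStein2015, Thm. 1.7]
[cite: Schneider1985, Thm. 2′ (p. 342)] [cite: BurungaleCastellaSkinner2025, Thm. 1.1.2 (a)] -/
theorem order_padicLFunction_eq_rank_iff_finite_sha (h85 : Schneider1985_order_charGenerator)
    (hMC : burungale_castella_skinner_charIdeal_eq_padicLFunction)
    (hp : 5 ≤ p) (hgood : W.HasGoodReductionAtPrime p) (hord : ¬ (p : ℤ) ∣ W.frobeniusTrace p)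
    (hirr : W.HasIrreducibleModPGaloisRep p)
    (hReg : ∀ D : PAdicHeightData W p, D.IsCanonical → SchneiderConjecture D)
    {N : ℕ} [NeZero N] {f : CuspForm (Gamma0 N) 2} (hf : IsNewformOf W f) :
    (padicLFunction f (unitRoot W p : ℚ_[p])).order = W.mordellWeilRank ↔
      Finite (AddCommGroup.primaryComponent W.sha p) := by
  obtain ⟨κ, hκ, γ, hγ, hγ'⟩ := exists_isCyclotomic_isTopGenerator_isCyclotomicVariable_holds p
  obtain ⟨D⟩ := W.nonempty_selmerDualData_holds κ γ hγ
  haveI : Module.Finite (IwasawaAlgebra p) D.X := D.module_finite_holds hγ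
  obtain ⟨hX, g, k, hchar, hιg⟩ := hMC W p κ γ f hp hgood hord hirr hκ hγ hγ' hf D
  obtain ⟨Dh, hDh⟩ := exists_isCanonical_holds W p hp hgood hord
  rw [order_eq_order_of_iwasawaToPowerSeries_eq p hιg,
    (h85 W p hp hgood hord κ γ hκ hγ hγ' D hX g hchar Dh hDh).2.1]
  exact ⟨fun h ↦ h.2, fun h ↦ ⟨hReg Dh hDh, h⟩⟩

/-- The same door in corank form: **`ord_{T=0} L_p(E,T) = rank E(ℚ) ⟺ t_p(E) = corank_{ℤ_p} Ш(E)[p^∞] = 0`**.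
CONDITIONAL on `h85`, `hMC`. [cite: BalakrishnanMullerStein2015, Thm. 1.7] [cite: BurungaleCastellaSkinner2025, Thm. 1.1.2 (a)] -/
theorem order_padicLFunction_eq_rank_iff_shaCorank_eq_zero (h85 : Schneider1985_order_charGenerator)
    (hMC : burungale_castella_skinner_charIdeal_eq_padicLFunction)
    (hp : 5 ≤ p) (hgood : W.HasGoodReductionAtPrime p) (hord : ¬ (p : ℤ) ∣ W.frobeniusTrace p)
    (hirr : W.HasIrreducibleModPGaloisRep p)
    (hReg : ∀ D : PAdicHeightData W p, D.IsCanonical → SchneiderConjecture D)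
    {N : ℕ} [NeZero N] {f : CuspForm (Gamma0 N) 2} (hf : IsNewformOf W f) :
    (padicLFunction f (unitRoot W p : ℚ_[p])).order = W.mordellWeilRank ↔ W.shaCorank p = 0 := by
  rw [order_padicLFunction_eq_rank_iff_finite_sha W p h85 hMC hp hgood hord hirr hReg hf,
    finite_primaryComponent_sha_iff_shaCorank_eq_zero]

/-- Off the door: granting the same two prints, `Ш(E/ℚ)[p^∞]` INFINITE forces the strict inequality
`rank E(ℚ) < ord_{T=0} L_p(E,T)` (Schneider at `p` assumed). CONDITIONAL on `h85`, `hMC`.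
[cite: BalakrishnanMullerStein2015, Thm. 1.7] [cite: BurungaleCastellaSkinner2025, Thm. 1.1.2 (a)] -/
theorem mordellWeilRank_lt_order_padicLFunction_of_not_finite_sha (h85 : Schneider1985_order_charGenerator)
    (hMC : burungale_castella_skinner_charIdeal_eq_padicLFunction)
    (hp : 5 ≤ p) (hgood : W.HasGoodReductionAtPrime p) (hord : ¬ (p : ℤ) ∣ W.frobeniusTrace p)
    (hirr : W.HasIrreducibleModPGaloisRep p)
    (hReg : ∀ D : PAdicHeightData W p, D.IsCanonical → SchneiderConjecture D)
    {N : ℕ} [NeZero N] {f : CuspForm (Gamma0 N) 2} (hf : IsNewformOf W f)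
    (hinf : ¬ Finite (AddCommGroup.primaryComponent W.sha p)) :
    (W.mordellWeilRank : ℕ∞) < (padicLFunction f (unitRoot W p : ℚ_[p])).order := by
  refine lt_of_le_of_ne (mordellWeilRank_le_order_padicLFunction_of_prints W p h85 hMC hp hgood hord hirr hf) ?_
  exact fun heq ↦
    hinf ((order_padicLFunction_eq_rank_iff_finite_sha W p h85 hMC hp hgood hord hirr hReg hf).mp heq.symm)

end General

/-! ## §2 The prime `2` is NOT available on Zywina's family: bad (additive) reduction at `2` -/

section AtTwo

variable {m n : ℕ}

/-- `2 ∣ Δ(E_{m,n}) = 2⁸·3²·m·q³·r²`. [cite: Zywina2025, §3 (discriminant of E_{m,n})] -/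
theorem two_dvd_Δ_zywinaCurveInt (m n : ℕ) : (2 : ℤ) ∣ (zywinaCurveInt m n).Δ := by
  rw [zywinaCurveInt_Δ]
  exact ⟨2 ^ 7 * 3 ^ 2 * (m : ℤ) * ((m + 16 * n ^ 2 : ℕ) : ℤ) ^ 3 * ((m + 25 * n ^ 2 : ℕ) : ℤ) ^ 2, by ring⟩

/-- **`2` is a prime of BAD reduction of every `E_{m,n}`** (`2 ∣ Δ_min`): there is no good-ordinary `2`-adic
`L`-function of `E_{m,n}`, so every door typed with `IsOrdinaryAt _ 2` is VACUOUS at the one prime where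
`Ш(E_{m,n})[p^∞]` is controlled. UNCONDITIONAL. [cite: SilvermanAEC2009, VII.5 Prop. 5.1 (a)] [cite: Zywina2025, Lemma 3.4] -/
theorem not_hasGoodReductionAtPrime_two_zywinaCurve (h : ZywinaAdmissible m n)
    [(zywinaCurve m n).IsGloballyMinimal] [Fact (Nat.Prime 2)] :
    ¬ (zywinaCurve m n).HasGoodReductionAtPrime 2 := by
  have hI : integralModelInt (zywinaCurve m n) = zywinaCurveInt m n := by
    convert integralModelInt_zywinaCurve h
  refine not_hasGoodReductionAtPrime_of_dvd_minimalDiscriminantInt _ 2 ?_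
  rw [IntModel.minimalDiscriminantInt_eq hI]
  exact_mod_cast two_dvd_Δ_zywinaCurveInt m n

/-- **No `2`-adic door on Zywina's family**: `IsOrdinaryAt (E_{m,n}) 2` is false for every admissible `(m, n)`.
UNCONDITIONAL. [cite: SilvermanAEC2009, VII.5 Prop. 5.1 (a)] -/
theorem not_isOrdinaryAt_two_zywinaCurve (h : ZywinaAdmissible m n) [(zywinaCurve m n).IsGloballyMinimal]
    [Fact (Nat.Prime 2)] : ¬ IsOrdinaryAt (zywinaCurve m n) 2 :=
  fun hord ↦ not_hasGoodReductionAtPrime_two_zywinaCurve h hord.1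

end AtTwo

/-! ## §3 `E_{m,n}[5]` is irreducible when `7 ∣ n`: the Frobenius certificate at `ℓ = 7` -/

section Irreducible

variable {m n : ℕ}

/-- A prime `k ≡ 11 (mod 24)` is not `7`, hence is not divisible by `7`. [folklore] -/
theorem seven_not_dvd_of_prime_of_mod {k : ℕ} (hk : k.Prime) (hmod : k % 24 = 11) : ¬ (7 : ℤ) ∣ (k : ℤ) :=
  fun h ↦ by have := (Nat.prime_dvd_prime_iff_eq (by norm_num) hk).1 (by exact_mod_cast h : 7 ∣ k); omega

/-- **`7 ∤ Δ(E_{m,n}) = 2⁸·3²·m·q³·r²`** for admissible `(m, n)`: `7` is a prime of good reduction of every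
`E_{m,n}`. [cite: Zywina2025, §3 (discriminant of E_{m,n})] -/
theorem seven_not_dvd_Δ_zywinaCurveInt (h : ZywinaAdmissible m n) : ¬ (7 : ℤ) ∣ (zywinaCurveInt m n).Δ := by
  have P := h.params
  have h7 : Prime (7 : ℤ) := Int.prime_iff_natAbs_prime.2 (by norm_num)
  have hm := seven_not_dvd_of_prime_of_mod P.m_prime P.m_mod
  have hq := seven_not_dvd_of_prime_of_mod P.q_prime P.q_mod
  have hr := seven_not_dvd_of_prime_of_mod P.r_prime P.r_mod
  rw [← P.q_eq] at hq
  rw [← P.r_eq] at hr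
  rw [zywinaCurveInt_Δ]
  intro hd
  rcases h7.dvd_or_dvd hd with h1 | h1
  · rcases h7.dvd_or_dvd h1 with h2 | h2
    · rcases h7.dvd_or_dvd h2 with h3 | h3
      · rcases h7.dvd_or_dvd h3 with h4 | h4
        · exact absurd (Int.Prime.dvd_pow' (by norm_num) h4) (by norm_num)
        · exact absurd (Int.Prime.dvd_pow' (by norm_num) h4) (by norm_num)
      · exact hm h3
    · exact hq (h7.dvd_of_dvd_pow h2)
  · exact hr (h7.dvd_of_dvd_pow h1)

/-- **`E_{m,n} mod 7 = [0, −5c, 0, 4c², 0] mod 7` with `c = m % 7`, when `7 ∣ n`** (`q ≡ r ≡ m (mod 7)`). [folklore] -/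
theorem map_zywinaCurveInt_zmod_seven (h7 : 7 ∣ n) :
    (zywinaCurveInt m n).map (Int.castRingHom (ZMod 7)) =
      ((⟨0, -5 * ((m : ℤ) % 7), 0, 4 * ((m : ℤ) % 7) ^ 2, 0⟩ : WeierstrassCurve ℤ).map
        (Int.castRingHom (ZMod 7))) := by
  have hn : ((n : ℕ) : ZMod 7) = 0 := by
    rw [ZMod.natCast_eq_zero_iff]; exact h7
  have hm : ((((m : ℤ) % 7 : ℤ)) : ZMod 7) = ((m : ℤ) : ZMod 7) := by
    have := ZMod.intCast_mod (m : ℤ) 7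
    simpa using this
  ext
  · simp [zywinaCurveInt]
  · simp only [zywinaCurveInt, map_a₂, eq_intCast]
    push_cast
    rw [hm, hn]
    push_cast
    ring
  · simp [zywinaCurveInt]
  · simp only [zywinaCurveInt, map_a₄, eq_intCast]
    push_cast
    rw [hm, hn]
    push_cast
    ring
  · simp [zywinaCurveInt]

/-- The residue `c = m % 7` is one of `1, …, 6` (`m` is a prime `≡ 11 (mod 24)`, so `m ≠ 7`). [folklore] -/
theorem residue_seven_mem (h : ZywinaAdmissible m n) :
    (m : ℤ) % 7 = 1 ∨ (m : ℤ) % 7 = 2 ∨ (m : ℤ) % 7 = 3 ∨ (m : ℤ) % 7 = 4 ∨ (m : ℤ) % 7 = 5 ∨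
      (m : ℤ) % 7 = 6 := by
  have P := h.params
  have hm := seven_not_dvd_of_prime_of_mod P.m_prime P.m_mod
  have hne : (m : ℤ) % 7 ≠ 0 := fun h0 ↦ hm (Int.dvd_of_emod_eq_zero h0)
  omega

/-- **The six point counts over `𝔽₇`** of `y² = x³ − 5c x² + 4c² x`, `c = 1, …, 6`: all equal to `8`, i.e.
`a₇ = 0` (kernel-decided). [cite: IrelandRosen1990, §18.4] -/
theorem natCard_seven_of_residue (c : ℤ) (hc : c = 1 ∨ c = 2 ∨ c = 3 ∨ c = 4 ∨ c = 5 ∨ c = 6) :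
    Nat.card (((⟨0, -5 * c, 0, 4 * c ^ 2, 0⟩ : WeierstrassCurve ℤ).map
      (Int.castRingHom (ZMod 7))).toAffine.Point) = 8 := by
  rcases hc with rfl | rfl | rfl | rfl | rfl | rfl
  · rw [show ((⟨0, -5 * 1, 0, 4 * 1 ^ 2, 0⟩ : WeierstrassCurve ℤ)) = ⟨0, -5, 0, 4, 0⟩ by norm_num,
      PointCountNat.natCard_point_map_eq (hℓ := ⟨by norm_num⟩) (by norm_num) 0 (-5) 0 4 0 (by decide +kernel)]
    decide +kernel
  · rw [show ((⟨0, -5 * 2, 0, 4 * 2 ^ 2, 0⟩ : WeierstrassCurve ℤ)) = ⟨0, -10, 0, 16, 0⟩ by norm_num,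
      PointCountNat.natCard_point_map_eq (hℓ := ⟨by norm_num⟩) (by norm_num) 0 (-10) 0 16 0 (by decide +kernel)]
    decide +kernel
  · rw [show ((⟨0, -5 * 3, 0, 4 * 3 ^ 2, 0⟩ : WeierstrassCurve ℤ)) = ⟨0, -15, 0, 36, 0⟩ by norm_num,
      PointCountNat.natCard_point_map_eq (hℓ := ⟨by norm_num⟩) (by norm_num) 0 (-15) 0 36 0 (by decide +kernel)]
    decide +kernel
  · rw [show ((⟨0, -5 * 4, 0, 4 * 4 ^ 2, 0⟩ : WeierstrassCurve ℤ)) = ⟨0, -20, 0, 64, 0⟩ by norm_num,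
      PointCountNat.natCard_point_map_eq (hℓ := ⟨by norm_num⟩) (by norm_num) 0 (-20) 0 64 0 (by decide +kernel)]
    decide +kernel
  · rw [show ((⟨0, -5 * 5, 0, 4 * 5 ^ 2, 0⟩ : WeierstrassCurve ℤ)) = ⟨0, -25, 0, 100, 0⟩ by norm_num,
      PointCountNat.natCard_point_map_eq (hℓ := ⟨by norm_num⟩) (by norm_num) 0 (-25) 0 100 0 (by decide +kernel)]
    decide +kernel
  · rw [show ((⟨0, -5 * 6, 0, 4 * 6 ^ 2, 0⟩ : WeierstrassCurve ℤ)) = ⟨0, -30, 0, 144, 0⟩ by norm_num,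
      PointCountNat.natCard_point_map_eq (hℓ := ⟨by norm_num⟩) (by norm_num) 0 (-30) 0 144 0 (by decide +kernel)]
    decide +kernel

/-- **`a₇(E_{m,n}) = 0` when `7 ∣ n`** (`#E_{m,n}(𝔽₇) = 8`), read off the integer model. [cite: IrelandRosen1990, §18.4] -/
theorem frobeniusTrace_seven_zywinaCurveInt (h : ZywinaAdmissible m n) (h7 : 7 ∣ n) :
    Literature.NumberTheory.Automorphic.frobeniusTrace (zywinaCurveInt m n) 7 = 0 := by
  rw [Literature.NumberTheory.Automorphic.frobeniusTrace, Literature.NumberTheory.Automorphic.numPointsMod,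
    map_zywinaCurveInt_zmod_seven h7, natCard_seven_of_residue ((m : ℤ) % 7) (residue_seven_mem h)]
  norm_num

/-- `E_{m,n} = (zywinaCurveInt m n) ⊗ ℚ` as a `map` along `Int.castRingHom ℚ`. [cite: Zywina2025, Thm 1.2] -/
theorem map_zywinaCurveInt_rat (m n : ℕ) :
    (zywinaCurveInt m n).map (Int.castRingHom ℚ) = zywinaCurve m n := by
  rw [← zywinaCurveInt_baseChange]; rfl

/-- The Frobenius certificate's polynomial at `(p, ℓ, a_ℓ) = (5, 7, 0)`: `X² + 7 ≡ X² + 2` has no root modulo `5`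
(kernel-decided; stated before any `Fact (Nat.Prime 5)` instance is in scope). [cite: Mazur1978, §6 Prop. 6.3 (1)] -/
theorem noroot_five_seven : ∀ t : ZMod 5, t ^ 2 - ((0 : ℤ) : ZMod 5) * t + ((7 : ℕ) : ZMod 5) ≠ 0 := by
  decide

/-- **`E_{m,n}[5]` is an irreducible `G_ℚ`-module whenever `7 ∣ n`**: Mazur's Frobenius certificate at the good
prime `ℓ = 7 ≠ 5` — `X² − a₇ X + 7 = X² + 7 ≡ X² + 2` has no root modulo `5`. UNCONDITIONAL.
[cite: Mazur1978, §6 Prop. 6.3 (1) (p. 153)] -/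
theorem hasIrreducibleModPGaloisRep_five_zywinaCurve (h : ZywinaAdmissible m n) (h7 : 7 ∣ n)
    [Fact (Nat.Prime 5)] : (zywinaCurve m n).HasIrreducibleModPGaloisRep 5 := by
  haveI : Fact (Nat.Prime 7) := ⟨by norm_num⟩
  rw [← map_zywinaCurveInt_rat]
  refine Rank2.hasIrreducibleModPGaloisRep_map_of_noroot (zywinaCurveInt m n) 5 7 (by norm_num)
    (seven_not_dvd_Δ_zywinaCurveInt h) ?_
  rw [frobeniusTrace_seven_zywinaCurveInt h h7]
  exact noroot_five_seven

end Irreducible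

/-! ## §4 The `5`-adic equality door on Zywina's family (members with `7 ∣ n`) -/

section DoorAtFive

variable {m n : ℕ}

/-- **THE `5`-ADIC EQUALITY DOOR ON ZYWINA'S FAMILY (member form).** For admissible `(m, n)` with `7 ∣ n` and
Schneider's conjecture for `E_{m,n}` at `5` (`hReg`; THEOREM R* on every class `zywinaClass 5 K m₁ M`, `K ≥ 1`,
`5 ∤ m₁`, `5^K ∤ m₁⁴ − 1` — `Rank2.schneiderConjecture_of_mem_zywinaClass`), granting only the prints `h85`, `hMC`
(rank `= 2`, `5` good ordinary, `E_{m,n}[5]` irreducible being tree theorems), for the newform `f` of `E_{m,n}`: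
**`ord_{T=0} L_5(E_{m,n}, T) = 2 ⟺ Ш(E_{m,n}/ℚ)[5^∞]` is finite** — the single non-print input between the window
`2 ≤ ord_{T=0} L_5` and `5`-adic BSD-rank on this family, exactly. CONDITIONAL on `h85`, `hMC`, `hReg`.
[cite: BalakrishnanMullerStein2015, Thm. 1.7] [cite: BurungaleCastellaSkinner2025, Thm. 1.1.2 (a)]
[cite: Zywina2025, Thm 1.2] [cite: Mazur1978, §6 Prop. 6.3 (1)] -/
theorem equalityDoor_five_zywinaCurve [Fact (Nat.Prime 5)] (h85 : Schneider1985_order_charGenerator)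
    (hMC : burungale_castella_skinner_charIdeal_eq_padicLFunction) (h : ZywinaAdmissible m n) (h7 : 7 ∣ n)
    [(zywinaCurve m n).IsElliptic] [(zywinaCurve m n).IsGloballyMinimal]
    (hReg : ∀ D : PAdicHeightData (zywinaCurve m n) 5, D.IsCanonical → SchneiderConjecture D)
    {N : ℕ} [NeZero N] {f : CuspForm (Gamma0 N) 2} (hf : IsNewformOf (zywinaCurve m n) f) :
    (padicLFunction f (unitRoot (zywinaCurve m n) 5 : ℚ_[5])).order = 2 ↔
      Finite (AddCommGroup.primaryComponent (zywinaCurve m n).sha 5) := by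
  obtain ⟨hgood, hord⟩ := goodOrdinary_five_zywinaCurve h
  have hiff := order_padicLFunction_eq_rank_iff_finite_sha (zywinaCurve m n) 5 h85 hMC le_rfl hgood hord
    (hasIrreducibleModPGaloisRep_five_zywinaCurve h h7) hReg hf
  rw [mordellWeilRank_zywinaCurve h] at hiff
  exact_mod_cast hiff

/-- The door in corank form: **`ord_{T=0} L_5(E_{m,n}, T) = 2 ⟺ t_5(E_{m,n}) = 0`** (admissible `(m, n)`, `7 ∣ n`,
Schneider at `5`). CONDITIONAL on `h85`, `hMC`, `hReg`. [cite: BalakrishnanMullerStein2015, Thm. 1.7]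
[cite: BurungaleCastellaSkinner2025, Thm. 1.1.2 (a)] -/
theorem equalityDoor_five_shaCorank_zywinaCurve [Fact (Nat.Prime 5)] (h85 : Schneider1985_order_charGenerator)
    (hMC : burungale_castella_skinner_charIdeal_eq_padicLFunction) (h : ZywinaAdmissible m n) (h7 : 7 ∣ n)
    [(zywinaCurve m n).IsElliptic] [(zywinaCurve m n).IsGloballyMinimal]
    (hReg : ∀ D : PAdicHeightData (zywinaCurve m n) 5, D.IsCanonical → SchneiderConjecture D)
    {N : ℕ} [NeZero N] {f : CuspForm (Gamma0 N) 2} (hf : IsNewformOf (zywinaCurve m n) f) :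
    (padicLFunction f (unitRoot (zywinaCurve m n) 5 : ℚ_[5])).order = 2 ↔ (zywinaCurve m n).shaCorank 5 = 0 := by
  rw [equalityDoor_five_zywinaCurve h85 hMC h h7 hReg hf, finite_primaryComponent_sha_iff_shaCorank_eq_zero]

/-- **Window and door together**: granting the two prints, `2 ≤ ord_{T=0} L_5(E_{m,n},T)` for EVERY admissible
`(m, n)` with `7 ∣ n` (no Kato, no height hypothesis); and, given Schneider at `5`, equality iff `Ш(E_{m,n})[5^∞]` is
finite, STRICT inequality iff it is infinite. CONDITIONAL on `h85`, `hMC` (+ `hReg` for the last two clauses).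
[cite: BalakrishnanMullerStein2015, Thm. 1.7] [cite: BurungaleCastellaSkinner2025, Thm. 1.1.2 (a)] -/
theorem window_and_door_five_zywinaCurve [Fact (Nat.Prime 5)] (h85 : Schneider1985_order_charGenerator)
    (hMC : burungale_castella_skinner_charIdeal_eq_padicLFunction) (h : ZywinaAdmissible m n) (h7 : 7 ∣ n)
    [(zywinaCurve m n).IsElliptic] [(zywinaCurve m n).IsGloballyMinimal]
    {N : ℕ} [NeZero N] {f : CuspForm (Gamma0 N) 2} (hf : IsNewformOf (zywinaCurve m n) f) :
    (2 : ℕ∞) ≤ (padicLFunction f (unitRoot (zywinaCurve m n) 5 : ℚ_[5])).order ∧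
      ((∀ D : PAdicHeightData (zywinaCurve m n) 5, D.IsCanonical → SchneiderConjecture D) →
        (((padicLFunction f (unitRoot (zywinaCurve m n) 5 : ℚ_[5])).order = 2 ↔
            Finite (AddCommGroup.primaryComponent (zywinaCurve m n).sha 5)) ∧
          ((2 : ℕ∞) < (padicLFunction f (unitRoot (zywinaCurve m n) 5 : ℚ_[5])).order ↔
            ¬ Finite (AddCommGroup.primaryComponent (zywinaCurve m n).sha 5)))) := by
  obtain ⟨hgood, hord⟩ := goodOrdinary_five_zywinaCurve h
  have hirr := hasIrreducibleModPGaloisRep_five_zywinaCurve h h7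
  have hle := mordellWeilRank_le_order_padicLFunction_of_prints (zywinaCurve m n) 5 h85 hMC le_rfl hgood hord
    hirr hf
  rw [mordellWeilRank_zywinaCurve h] at hle
  refine ⟨by exact_mod_cast hle, fun hReg ↦ ?_⟩
  have hdoor := equalityDoor_five_zywinaCurve h85 hMC h h7 hReg hf
  refine ⟨hdoor, ?_⟩
  rw [← hdoor, lt_iff_le_and_ne]
  exact ⟨fun hh heq ↦ hh.2 heq.symm, fun hne ↦ ⟨by exact_mod_cast hle, fun heq ↦ hne heq.symm⟩⟩

end DoorAtFive

/-! ## §5 Consequences for the crux T = `FiniteShaComponentTransfer` -/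

section Transfer

variable {m n : ℕ}

/-- **T PREDICTS `5`-adic BSD-rank on the family.** Granting T (`FiniteShaComponentTransfer`), the two prints
and Schneider at `5`: for admissible `(m, n)` with `7 ∣ n`, `ord_{T=0} L_5(E_{m,n}, T) = 2` (`t_2 = 0` is Zywina's
theorem, T gives `t_5 = 0`, the door converts it); a member with `ord_{T=0} L_5 ≥ 3` would REFUTE T (given R*).
CONDITIONAL on `hT`, `h85`, `hMC`, `hReg`. [cite: Zywina2025, Thm 1.2] [cite: BalakrishnanMullerStein2015, Thm. 1.7] -/
theorem order_eq_two_of_transfer_zywinaCurve [Fact (Nat.Prime 5)] (hT : FiniteShaComponentTransfer)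
    (h85 : Schneider1985_order_charGenerator) (hMC : burungale_castella_skinner_charIdeal_eq_padicLFunction)
    (h : ZywinaAdmissible m n) (h7 : 7 ∣ n) [(zywinaCurve m n).IsElliptic] [(zywinaCurve m n).IsGloballyMinimal]
    (hReg : ∀ D : PAdicHeightData (zywinaCurve m n) 5, D.IsCanonical → SchneiderConjecture D)
    {N : ℕ} [NeZero N] {f : CuspForm (Gamma0 N) 2} (hf : IsNewformOf (zywinaCurve m n) f) :
    (padicLFunction f (unitRoot (zywinaCurve m n) 5 : ℚ_[5])).order = 2 := by
  haveI : Fact (Nat.Prime 2) := ⟨Nat.prime_two⟩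
  exact (equalityDoor_five_shaCorank_zywinaCurve h85 hMC h h7 hReg hf).mpr
    (hT (zywinaCurve m n) 2 5 (shaCorank_two_zywinaCurve h))

/-- **T's instance `(E_{m,n}, 2, 5)` IS the `5`-adic BSD-rank statement** (admissible `(m, n)`, `7 ∣ n`, Schneider at
`5`, granting the two prints): `(t_2(E_{m,n}) = 0 → t_5(E_{m,n}) = 0) ⟺ ord_{T=0} L_5(E_{m,n}, T) = 2` — the converse
that `crossPrimeRow_zywinaCurve_iff_order_eq_two` lacked, and without Kato's rank bound. CONDITIONAL on `h85`, `hMC`,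
`hReg`. [cite: Zywina2025, Thm 1.2] [cite: BalakrishnanMullerStein2015, Thm. 1.7] [cite: BurungaleCastellaSkinner2025, Thm. 1.1.2 (a)] -/
theorem transfer_instance_iff_order_eq_two [Fact (Nat.Prime 5)] [Fact (Nat.Prime 2)]
    (h85 : Schneider1985_order_charGenerator) (hMC : burungale_castella_skinner_charIdeal_eq_padicLFunction)
    (h : ZywinaAdmissible m n) (h7 : 7 ∣ n) [(zywinaCurve m n).IsElliptic] [(zywinaCurve m n).IsGloballyMinimal]
    (hReg : ∀ D : PAdicHeightData (zywinaCurve m n) 5, D.IsCanonical → SchneiderConjecture D)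
    {N : ℕ} [NeZero N] {f : CuspForm (Gamma0 N) 2} (hf : IsNewformOf (zywinaCurve m n) f) :
    ((zywinaCurve m n).shaCorank 2 = 0 → (zywinaCurve m n).shaCorank 5 = 0) ↔
      (padicLFunction f (unitRoot (zywinaCurve m n) 5 : ℚ_[5])).order = 2 := by
  rw [equalityDoor_five_shaCorank_zywinaCurve h85 hMC h h7 hReg hf]
  exact ⟨fun hh ↦ hh (shaCorank_two_zywinaCurve h), fun hh _ ↦ hh⟩

end Transfer

end Summit.BirchSwinnertonDyer.BirchSwinnertonDyer.Theorems.ShaPrimaryTransferZywinaEqualityDoor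
end
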